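import Summits.Ventures.PercRepro.RankLevelSetAbsorbStarThreeExcess

/-! # RankLevelSetAbsorbStarThree — THE STEP `k = 3` OF (ABS-star) HOLDS FOR EVERY FINITE MATROID AND EVERY
`y` IN NO PARALLEL PAIR: `(#E − 4) · A^y_3 ≤ 3 · A^y_4` FOR `7 ≤ #E` (night-1 g34; dossier §46)

For a finite matroid `M` on `n = #E` elements and `y ∈ E` with `y ∉ cl {z}` for every `z ≠ y` (no parallel
partner), the absorbing avoid-`y` profile `A^y_k = #lowAbsorbAt M y k` (g28/g32) satisfies the star-normalized step
of g33's (ABS-star) at `k = 3`: **`absorbStar_step_three`**. PROOF (the LOCAL CHARGING (L) of dossier §46.5 —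
uniform spreading): each member `Z ∈ A^y_3` distributes weight `1` evenly over its `#upNbrs Z = n − 4 − #excess Z`
up-neighbours (`sum_wt_upNbrs`; `RankLevelSetAbsorbStarThreeExcess`), so `A^y_3 = Σ_W Σ_{Z ⊂ W} 1/#upNbrs Z`, and
the inner sum is at most `3/(n − 4)` at every `W ∈ A^y_4` (`sum_wt_downNbrs_le`): `W` has at most TWO down-neighbours
(`card_downNbrs_le_two` — three removable elements `a, b, c` of `W = {a, b, c, d}` would give `y ∈ cl {c, d} ∩
cl {b, d}` and then `y ∈ cl {d}` by the exchange property, `not_three_absorb`), each weight is at most `1/(n − 6)`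
(the excess has at most `2` elements), and when there are two down-neighbours each weight is at most `1/(n − 5)`,
because a FULL excess `{f, g}` of `Z = W ∖ {e}` makes `{f, g, y}` span `cl Z ⊇ Z`, putting every other element of `W`
into `cl (E ∖ W)` and leaving `Z` as the only down-neighbour (`downNbrs_eq_singleton_of_excess`). Then
`1/(n − 6) ≤ 3/(n − 4)` and `2/(n − 5) ≤ 3/(n − 4)` for `n ≥ 7`. CENSUS (night-1 g34, own exact code): this uniform
spreading decides every step `k ≤ 3` below and at the middle for non-parallel `y` on every matroid with ≤ 9 elements,
and FAILS at `k = 4` (random binary matroids on 10 elements, profile of excesses `(1, 1, 2)`), where the Hall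
condition of the containment graph still holds: the steps `k ≥ 4` need non-uniform weights (dossier §46.5′). For a
parallel `y` the step at `k` is the normalized Mono step `j = k − 1` of `M ／ y ＼ z` (not covered here). Nothing
here asserts (ABS-star); every declaration has a docstring; imports: the cell's own modules and Mathlib only.
Axioms: standard. -/

namespace PercRepro

open Set Matroid

variable {α : Type} [DecidableEq α] (M : Matroid α) [M.Finite]

/-! ## Three removable elements force a parallel pair -/

omit [DecidableEq α] [M.Finite] in
/-- **For `y` in no parallel pair, three distinct elements of a member `{a, b, c, d}` at level `4` cannot all be
removable**: `y ∈ cl {b, c, d} ∩ cl {a, c, d} ∩ cl {a, b, d}` forces `y ∈ cl {c, d} ∩ cl {b, d}` and then `y ∈ cl {d}`,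
by the exchange property against the independence of `W`. -/
lemma not_three_absorb {y a b c d : α} (hy : y ∈ M.E) (hnp : ∀ z, z ≠ y → y ∉ M.closure {z})
    (hab : a ≠ b) (hac : a ≠ c) (had : a ≠ d) (hbc : b ≠ c) (hbd : b ≠ d) (hcd : c ≠ d)
    (hW : ({a, b, c, d} : Set α) ∈ lowAbsorbAt M y 4) (h1 : y ∈ M.closure {b, c, d})
    (h2 : y ∈ M.closure {a, c, d}) (h3 : y ∈ M.closure {a, b, d}) : False := by
  obtain ⟨⟨hWE, -, hWind, -⟩, hyW, -⟩ := hW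
  have hWE' := hWE
  have haE : a ∈ M.E := hWE (by simp)
  have hbE : b ∈ M.E := hWE (by simp)
  have hcE : c ∈ M.E := hWE (by simp)
  have hdE : d ∈ M.E := hWE (by simp)
  have hyd : y ≠ d := fun h => hyW (by simp [h])
  -- a generic rank bound: `W ⊆ cl X` with `#X ≤ 3` is impossible
  have hrank : ∀ X : Set α, X.encard ≤ 3 → ¬ (({a, b, c, d} : Set α) ⊆ M.closure X) := by
    intro X hX hsub
    have h := hWind.encard_le_eRk_of_subset hsub
    have habcd : a ∉ ({b, c, d} : Set α) := by
      simp only [Set.mem_insert_iff, Set.mem_singleton_iff, not_or]; exact ⟨hab, hac, had⟩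
    have hbcd : b ∉ ({c, d} : Set α) := by
      simp only [Set.mem_insert_iff, Set.mem_singleton_iff, not_or]; exact ⟨hbc, hbd⟩
    rw [M.eRk_closure_eq, Set.encard_insert_of_notMem habcd, Set.encard_insert_of_notMem hbcd,
      Set.encard_pair hcd] at h
    have h' := h.trans ((M.eRk_le_encard X).trans hX)
    norm_num at h'
  -- Step A: `y ∈ cl {c, d}`
  have hA : y ∈ M.closure {c, d} := by
    by_contra hno
    have hb := (M.closure_exchange ⟨h1, hno⟩).1
    have ha := (M.closure_exchange ⟨h2, hno⟩).1
    refine hrank (insert y {c, d}) ?_ ?_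
    · have hycd : y ∉ ({c, d} : Set α) := by
        simp only [Set.mem_insert_iff, Set.mem_singleton_iff, not_or]
        exact ⟨fun h => hyW (by simp [h]), hyd⟩
      rw [Set.encard_insert_of_notMem hycd, Set.encard_pair hcd]; norm_num
    · intro x hx
      simp only [Set.mem_insert_iff, Set.mem_singleton_iff] at hx
      rcases hx with rfl | rfl | rfl | rfl
      · exact ha
      · exact hb
      · exact M.subset_closure _ (Set.insert_subset hy (Set.insert_subset hcE (Set.singleton_subset_iff.mpr hdE)))
          (by simp)
      · exact M.subset_closure _ (Set.insert_subset hy (Set.insert_subset hcE (Set.singleton_subset_iff.mpr hdE)))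
          (by simp)
  -- Step B: `y ∈ cl {b, d}` (from `{b, c, d} = insert c {b, d}` and `{a, b, d} = insert a {b, d}`)
  have h1' : y ∈ M.closure (insert c {b, d}) := by
    have : ({b, c, d} : Set α) = insert c {b, d} := Set.insert_comm b c {d}
    rwa [this] at h1
  have hB : y ∈ M.closure {b, d} := by
    by_contra hno
    have hc := (M.closure_exchange ⟨h1', hno⟩).1
    have ha := (M.closure_exchange ⟨h3, hno⟩).1
    refine hrank (insert y {b, d}) ?_ ?_
    · have hybd : y ∉ ({b, d} : Set α) := by
        simp only [Set.mem_insert_iff, Set.mem_singleton_iff, not_or]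
        exact ⟨fun h => hyW (by simp [h]), hyd⟩
      rw [Set.encard_insert_of_notMem hybd, Set.encard_pair hbd]; norm_num
    · intro x hx
      simp only [Set.mem_insert_iff, Set.mem_singleton_iff] at hx
      rcases hx with rfl | rfl | rfl | rfl
      · exact ha
      · exact M.subset_closure _ (Set.insert_subset hy (Set.insert_subset hbE (Set.singleton_subset_iff.mpr hdE)))
          (by simp)
      · exact hc
      · exact M.subset_closure _ (Set.insert_subset hy (Set.insert_subset hbE (Set.singleton_subset_iff.mpr hdE)))
          (by simp)
  -- Step C: `y ∈ cl {d}`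
  have hC : y ∈ M.closure {d} := by
    by_contra hno
    have hc := (M.closure_exchange (X := {d}) ⟨hA, hno⟩).1
    have hb := (M.closure_exchange (X := {d}) ⟨hB, hno⟩).1
    have hsub : ({b, c, d} : Set α) ⊆ M.closure (insert y {d}) := by
      intro x hx
      simp only [Set.mem_insert_iff, Set.mem_singleton_iff] at hx
      rcases hx with rfl | rfl | rfl
      · exact hb
      · exact hc
      · exact M.subset_closure _ (Set.insert_subset hy (Set.singleton_subset_iff.mpr hdE)) (by simp)
    have hind3 : M.Indep {b, c, d} := hWind.subset (by
      intro x hx; simp only [Set.mem_insert_iff, Set.mem_singleton_iff] at hx ⊢; tauto)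
    have h := hind3.encard_le_eRk_of_subset hsub
    have hbcd : b ∉ ({c, d} : Set α) := by
      simp only [Set.mem_insert_iff, Set.mem_singleton_iff, not_or]; exact ⟨hbc, hbd⟩
    rw [M.eRk_closure_eq, Set.encard_insert_of_notMem hbcd, Set.encard_pair hcd] at h
    have h' := h.trans (M.eRk_le_encard _)
    rw [Set.encard_pair hyd] at h'
    norm_num at h'
  exact hnp d (Ne.symm hyd) hC

/-! ## At most two down-neighbours, the per-`W` bound, and the theorem -/

/-- **A member at level `4` has at most two down-neighbours when `y` is in no parallel pair** (`not_three_absorb`). -/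
lemma card_downNbrs_le_two {y : α} (hy : y ∈ M.E) (hnp : ∀ z, z ≠ y → y ∉ M.closure {z}) {W : Finset α}
    (hW : W ∈ absorbFinset M y 4) : (downNbrs M y 3 W).card ≤ 2 := by
  by_contra hlt
  push Not at hlt
  obtain ⟨Z₁, hZ₁, Z₂, hZ₂, Z₃, hZ₃, h12, h13, h23⟩ := Finset.two_lt_card.mp hlt
  obtain ⟨e₁, he₁W, rfl, he₁⟩ := exists_erase_of_mem_downNbrs M hW hZ₁
  obtain ⟨e₂, he₂W, rfl, he₂⟩ := exists_erase_of_mem_downNbrs M hW hZ₂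
  obtain ⟨e₃, he₃W, rfl, he₃⟩ := exists_erase_of_mem_downNbrs M hW hZ₃
  have hW' := (mem_absorbFinset M).mp hW
  have hWk : W.card = 4 := by have := hW'.1.2.1; rwa [Set.ncard_coe_finset] at this
  have hne : ∀ {a b : α}, a ∈ W → b ∈ W → W.erase a ≠ W.erase b → a ≠ b := by
    intro a b _ _ h hab
    exact h (by rw [hab])
  have h12' : e₁ ≠ e₂ := hne he₁W he₂W h12
  have h13' : e₁ ≠ e₃ := hne he₁W he₃W h13
  have h23' : e₂ ≠ e₃ := hne he₂W he₃W h23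
  -- the fourth element `d`
  have hsub3 : ({e₁, e₂, e₃} : Finset α) ⊆ W := by
    intro x hx
    simp only [Finset.mem_insert, Finset.mem_singleton] at hx
    rcases hx with rfl | rfl | rfl <;> assumption
  have hcard3 : ({e₁, e₂, e₃} : Finset α).card = 3 := by
    rw [Finset.card_insert_of_notMem (by simp [h12', h13']), Finset.card_insert_of_notMem (by simp [h23']),
      Finset.card_singleton]
  have hcardT : (W \ {e₁, e₂, e₃}).card = 1 := by rw [Finset.card_sdiff_of_subset hsub3, hWk, hcard3]
  obtain ⟨d, hd⟩ := Finset.card_eq_one.mp hcardT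
  have hdW : d ∈ W := (Finset.mem_sdiff.mp (hd ▸ Finset.mem_singleton_self d)).1
  have hd3 : d ∉ ({e₁, e₂, e₃} : Finset α) := (Finset.mem_sdiff.mp (hd ▸ Finset.mem_singleton_self d)).2
  have hd1 : e₁ ≠ d := fun h => hd3 (by simp [h])
  have hd2 : e₂ ≠ d := fun h => hd3 (by simp [h])
  have hd3' : e₃ ≠ d := fun h => hd3 (by simp [h])
  have hWeq : W = {e₁, e₂, e₃, d} := by
    ext x
    simp only [Finset.mem_insert, Finset.mem_singleton]
    constructor
    · intro hx
      by_cases h3 : x ∈ ({e₁, e₂, e₃} : Finset α)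
      · simp only [Finset.mem_insert, Finset.mem_singleton] at h3; tauto
      · have : x ∈ W \ {e₁, e₂, e₃} := Finset.mem_sdiff.mpr ⟨hx, h3⟩
        rw [hd, Finset.mem_singleton] at this
        exact Or.inr (Or.inr (Or.inr this))
    · rintro (rfl | rfl | rfl | rfl) <;> assumption
  -- the three erasures as sets
  have hE1 : (↑(W.erase e₁) : Set α) = {e₂, e₃, d} := by
    rw [hWeq, Finset.erase_insert (by simp [h12', h13', hd1])]; simp
  have hE2 : (↑(W.erase e₂) : Set α) = {e₁, e₃, d} := by
    rw [hWeq, Finset.erase_insert_of_ne h12', Finset.erase_insert (by simp [h23', hd2])]; simp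
  have hE3 : (↑(W.erase e₃) : Set α) = {e₁, e₂, d} := by
    rw [hWeq, Finset.erase_insert_of_ne h13', Finset.erase_insert_of_ne h23',
      Finset.erase_insert (by simp [hd3'])]; simp
  have hWset : (↑W : Set α) = {e₁, e₂, e₃, d} := by rw [hWeq]; simp
  have hy1 := mem_closure_of_mem_lowAbsorbAt M hy ((mem_absorbFinset M).mp (Finset.mem_filter.mp hZ₁).1)
  have hy2 := mem_closure_of_mem_lowAbsorbAt M hy ((mem_absorbFinset M).mp (Finset.mem_filter.mp hZ₂).1)
  have hy3 := mem_closure_of_mem_lowAbsorbAt M hy ((mem_absorbFinset M).mp (Finset.mem_filter.mp hZ₃).1)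
  rw [hE1] at hy1
  rw [hE2] at hy2
  rw [hE3] at hy3
  rw [hWset] at hW'
  exact not_three_absorb M hy hnp h12' h13' hd1 h23' hd2 hd3' hW' hy1 hy2 hy3

/-- **The weight of a member at level `3`**: `1 / #upNbrs Z`. -/
noncomputable def wt (y : α) (Z : Finset α) : ℚ := 1 / ((upNbrs M y 3 Z).card : ℚ)

/-- **A down-neighbour of a member at level `4` has weight at most `1 / (#E − 6)`, and at most `1 / (#E − 5)` when
`W` has another down-neighbour** (a full excess would force a unique down-neighbour). -/
lemma wt_le {y : α} (hy : y ∈ M.E) {W : Finset α} (hW : W ∈ absorbFinset M y 4) {Z : Finset α}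
    (hZ : Z ∈ downNbrs M y 3 W) :
    (M.E.ncard : ℚ) - 6 ≤ ((upNbrs M y 3 Z).card : ℚ) ∧
      (2 ≤ (downNbrs M y 3 W).card → (M.E.ncard : ℚ) - 5 ≤ ((upNbrs M y 3 Z).card : ℚ)) := by
  have hZA : Z ∈ absorbFinset M y 3 := (Finset.mem_filter.mp hZ).1
  have h1 := card_upNbrs_eq M hy hZA
  have h2 := card_exFinset_le M hy hZA
  constructor
  · have : M.E.ncard ≤ (upNbrs M y 3 Z).card + 6 := by omega
    have h' : (M.E.ncard : ℚ) ≤ ((upNbrs M y 3 Z).card : ℚ) + 6 := by exact_mod_cast this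
    linarith
  · intro hcard
    have hex : (exFinset M y Z).card ≤ 1 := by
      by_contra hno
      push Not at hno
      have hex2 : (exFinset M y Z).card = 2 := by omega
      obtain ⟨f, g, hfg, hfgeq⟩ := Finset.card_eq_two.mp hex2
      have hf : f ∈ exFinset M y Z := by rw [hfgeq]; simp
      have hg : g ∈ exFinset M y Z := by rw [hfgeq]; simp
      have := downNbrs_eq_singleton_of_excess M hy hW hZ hf hg hfg
      rw [this, Finset.card_singleton] at hcard
      omega
    have : M.E.ncard ≤ (upNbrs M y 3 Z).card + 5 := by omega
    have h' : (M.E.ncard : ℚ) ≤ ((upNbrs M y 3 Z).card : ℚ) + 5 := by exact_mod_cast this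
    linarith

/-- **The per-`W` bound**: for `y` in no parallel pair and `7 ≤ #E`, the weights of the down-neighbours of a member
`W` at level `4` sum to at most `3 / (#E − 4)`. -/
lemma sum_wt_downNbrs_le {y : α} (hy : y ∈ M.E) (hnp : ∀ z, z ≠ y → y ∉ M.closure {z}) (hn : 7 ≤ M.E.ncard)
    {W : Finset α} (hW : W ∈ absorbFinset M y 4) :
    ∑ Z ∈ downNbrs M y 3 W, wt M y Z ≤ 3 / ((M.E.ncard : ℚ) - 4) := by
  have hn' : (7 : ℚ) ≤ (M.E.ncard : ℚ) := by exact_mod_cast hn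
  have hle2 := card_downNbrs_le_two M hy hnp hW
  have hpos4 : (0 : ℚ) < (M.E.ncard : ℚ) - 4 := by linarith
  rcases Nat.lt_or_ge (downNbrs M y 3 W).card 1 with h0 | h1
  · -- empty
    have : downNbrs M y 3 W = ∅ := Finset.card_eq_zero.mp (by omega)
    rw [this, Finset.sum_empty]
    positivity
  rcases Nat.lt_or_ge (downNbrs M y 3 W).card 2 with h1' | h2
  · -- a single down-neighbour
    obtain ⟨Z, hZeq⟩ := Finset.card_eq_one.mp (by omega : (downNbrs M y 3 W).card = 1)
    have hZ : Z ∈ downNbrs M y 3 W := by rw [hZeq]; simp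
    obtain ⟨hu, -⟩ := wt_le M hy hW hZ
    rw [hZeq, Finset.sum_singleton, wt]
    have hpos6 : (0 : ℚ) < (M.E.ncard : ℚ) - 6 := by linarith
    calc (1 : ℚ) / ((upNbrs M y 3 Z).card : ℚ) ≤ 1 / ((M.E.ncard : ℚ) - 6) :=
          one_div_le_one_div_of_le hpos6 hu
      _ ≤ 3 / ((M.E.ncard : ℚ) - 4) := by
          rw [div_le_div_iff₀ hpos6 hpos4]; linarith
  · -- two down-neighbours
    have h2' : (downNbrs M y 3 W).card = 2 := by omega
    obtain ⟨Z₁, Z₂, hne, hZeq⟩ := Finset.card_eq_two.mp h2'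
    have hZ₁ : Z₁ ∈ downNbrs M y 3 W := by rw [hZeq]; simp
    have hZ₂ : Z₂ ∈ downNbrs M y 3 W := by rw [hZeq]; simp
    obtain ⟨-, hu₁⟩ := wt_le M hy hW hZ₁
    obtain ⟨-, hu₂⟩ := wt_le M hy hW hZ₂
    have hu₁' := hu₁ h2
    have hu₂' := hu₂ h2
    rw [hZeq, Finset.sum_pair hne, wt, wt]
    have hpos5 : (0 : ℚ) < (M.E.ncard : ℚ) - 5 := by linarith
    have e₁ : (1 : ℚ) / ((upNbrs M y 3 Z₁).card : ℚ) ≤ 1 / ((M.E.ncard : ℚ) - 5) :=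
      one_div_le_one_div_of_le hpos5 hu₁'
    have e₂ : (1 : ℚ) / ((upNbrs M y 3 Z₂).card : ℚ) ≤ 1 / ((M.E.ncard : ℚ) - 5) :=
      one_div_le_one_div_of_le hpos5 hu₂'
    calc (1 : ℚ) / ((upNbrs M y 3 Z₁).card : ℚ) + 1 / ((upNbrs M y 3 Z₂).card : ℚ)
        ≤ 1 / ((M.E.ncard : ℚ) - 5) + 1 / ((M.E.ncard : ℚ) - 5) := add_le_add e₁ e₂
      _ = 2 / ((M.E.ncard : ℚ) - 5) := by ring
      _ ≤ 3 / ((M.E.ncard : ℚ) - 4) := by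
          rw [div_le_div_iff₀ hpos5 hpos4]; linarith

/-- **Every member at level `3` distributes weight exactly `1` over its up-neighbours** (`7 ≤ #E`). -/
lemma sum_wt_upNbrs {y : α} (hy : y ∈ M.E) (hn : 7 ≤ M.E.ncard) {Z : Finset α} (hZ : Z ∈ absorbFinset M y 3) :
    ∑ W ∈ absorbFinset M y 4, (if Z ⊆ W then wt M y Z else 0) = 1 := by
  rw [← Finset.sum_filter]
  have hsum : ∑ W ∈ (absorbFinset M y 4).filter (fun W => Z ⊆ W), wt M y Z
      = ((upNbrs M y 3 Z).card : ℚ) * wt M y Z := by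
    rw [Finset.sum_const, nsmul_eq_mul]; rfl
  rw [hsum, wt]
  have hpos : (0 : ℚ) < ((upNbrs M y 3 Z).card : ℚ) := by
    have h1 := card_upNbrs_eq M hy hZ
    have h2 := card_exFinset_le M hy hZ
    have : 1 ≤ (upNbrs M y 3 Z).card := by omega
    exact_mod_cast this
  field_simp

/-- **THE STEP `k = 3` OF (ABS-star) FOR EVERY FINITE MATROID AND EVERY `y` IN NO PARALLEL PAIR**: for `y ∈ E`
with `y ∉ cl {z}` for all `z ≠ y`, and `7 ≤ #E`, `(#E − 4) · A^y_3 ≤ 3 · A^y_4`. -/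
theorem absorbStar_step_three {y : α} (hy : y ∈ M.E) (hnp : ∀ z, z ≠ y → y ∉ M.closure {z})
    (hn : 7 ≤ M.E.ncard) : (M.E.ncard - 4) * lowAbsorbCount M y 3 ≤ 3 * lowAbsorbCount M y 4 := by
  rw [lowAbsorbCount_eq_card, lowAbsorbCount_eq_card]
  set A3 := absorbFinset M y 3
  set A4 := absorbFinset M y 4
  have hn' : (7 : ℚ) ≤ (M.E.ncard : ℚ) := by exact_mod_cast hn
  have hpos4 : (0 : ℚ) < (M.E.ncard : ℚ) - 4 := by linarith
  -- the double count
  have hS : (A3.card : ℚ) = ∑ W ∈ A4, ∑ Z ∈ downNbrs M y 3 W, wt M y Z := by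
    calc (A3.card : ℚ) = ∑ Z ∈ A3, (1 : ℚ) := by simp
      _ = ∑ Z ∈ A3, ∑ W ∈ A4, (if Z ⊆ W then wt M y Z else 0) :=
          Finset.sum_congr rfl (fun Z hZ => (sum_wt_upNbrs M hy hn hZ).symm)
      _ = ∑ W ∈ A4, ∑ Z ∈ A3, (if Z ⊆ W then wt M y Z else 0) := Finset.sum_comm
      _ = ∑ W ∈ A4, ∑ Z ∈ downNbrs M y 3 W, wt M y Z :=
          Finset.sum_congr rfl (fun W _ => by rw [downNbrs, Finset.sum_filter])
  have hle : (A3.card : ℚ) ≤ (A4.card : ℚ) * (3 / ((M.E.ncard : ℚ) - 4)) := by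
    rw [hS]
    calc ∑ W ∈ A4, ∑ Z ∈ downNbrs M y 3 W, wt M y Z
        ≤ ∑ W ∈ A4, 3 / ((M.E.ncard : ℚ) - 4) :=
          Finset.sum_le_sum (fun W hW => sum_wt_downNbrs_le M hy hnp hn hW)
      _ = (A4.card : ℚ) * (3 / ((M.E.ncard : ℚ) - 4)) := by rw [Finset.sum_const, nsmul_eq_mul]
  have hq : ((M.E.ncard : ℚ) - 4) * (A3.card : ℚ) ≤ 3 * (A4.card : ℚ) := by
    have := mul_le_mul_of_nonneg_left hle hpos4.le
    rw [mul_comm (A4.card : ℚ), ← mul_assoc, mul_div_assoc', mul_comm ((M.E.ncard : ℚ) - 4) 3,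
      mul_div_assoc, div_self hpos4.ne', mul_one] at this
    linarith
  have hcast : (((M.E.ncard - 4 : ℕ) : ℚ)) = (M.E.ncard : ℚ) - 4 := by
    rw [Nat.cast_sub (by omega)]; norm_num
  have hq' : (((M.E.ncard - 4) * A3.card : ℕ) : ℚ) ≤ ((3 * A4.card : ℕ) : ℚ) := by
    push_cast
    rw [hcast]
    exact hq
  exact_mod_cast hq'

omit [DecidableEq α] in
/-- **(ABS-star) HOLDS AT EVERY STEP `k ≤ 3` OF EVERY LOOPLESS MATROID WITHOUT PARALLEL PAIRS**: if no element lies in the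
closure of another single element (`hsimple`), then for every `y ∈ E` and `k ≤ 3` with `2k + 1 ≤ #E`,
`(#E − 1 − k) · A^y_k ≤ k · A^y_{k+1}` — the shape of `BiIndepAbsorbStar` at `k ≤ 3` (`absorbStar_of_le_two` for
`k ≤ 2`, `absorbStar_step_three` for `k = 3`). -/
theorem absorbStar_of_le_three (hsimple : ∀ y ∈ M.E, ∀ z, z ≠ y → y ∉ M.closure {z}) {y : α} (hy : y ∈ M.E)
    {k : ℕ} (hk3 : k ≤ 3) (hk : 2 * k + 1 ≤ M.E.ncard) :
    (M.E.ncard - 1 - k) * lowAbsorbCount M y k ≤ k * lowAbsorbCount M y (k + 1) := by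
  classical
  rcases Nat.lt_or_ge k 3 with h2 | h3
  · exact absorbStar_of_le_two M hy (by omega) hk
  · have hk3' : k = 3 := by omega
    subst hk3'
    rw [show M.E.ncard - 1 - 3 = M.E.ncard - 4 by omega]
    exact absorbStar_step_three M hy (hsimple y hy) (by omega)

end PercRepro
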